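import Mathlib
import Summits.PneNP.PneNP.Theorems.SoloBlindStreamingDegree
import Summits.PneNP.PneNP.Theorems.SoloBlindSparseHierarchy
import HarnessLib

/-!
# Sparse `P`-languages outside every level `USTREAM(Nᵏ+k, Nᵏ+k)`: PROPOSITION G′ in one-pass form

(Solo seat `solo-PneNP-blind`; sequel to `SoloBlindSparseHierarchy` (PROPOSITION G′, `DTIME`
form) and `SoloBlindStreamingDegree` (THEOREM D♯: one exponent `d(k)` with
`USTREAM(Nᵏ+k) ⊆ DTIME(nᵈ)`).)

THEOREM E of the seat's report (`SoloBlindStreamingCompleteness`) calibrates the summit as a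
uniform ONE-PASS lower bound for ONE language, `PneNP ↔ ∀ k, SAT ∉ USTREAM (Nᵏ+k) (Nᵏ+k)`, of which
no level `k ≥ 1` is known. Here every level of the same family gets an UNCONDITIONAL SPARSE witness
in `P`, so that the one-pass reading of "hardness magnification for ALL sparse languages" is again
exactly the summit:

* `exists_sparse_mem_P_not_mem_USTREAM_pow` — for every `k` there is a SPARSE `L ∈ P` with
  `L ∉ USTREAM (Nᵏ+k) (Nᵏ+k)` (THEOREM D♯ + the sparse time hierarchy
  `exists_sparse_mem_P_not_mem_DTIME_pow`);
* `sparseStreamingMagnification_iff_pneNP` — **PROPOSITION G′, one-pass form**: for every `k`,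
  `(∀ L sparse, L ∈ P → (NP ⊆ P → L ∈ USTREAM (Nᵏ+k) (Nᵏ+k))) ↔ PneNP`;
* `exists_sparse_streamingMagnification_iff_pneNP` — one explicit sparse `L ∈ P` whose one-pass
  magnification statement at level `k` is the summit.

Reading. In the family `USTREAM(Nᵏ+k)` the levels are unconditionally separated from `P` by sparse
languages at EVERY `k`; what is open (and, by THEOREM E, equivalent to the summit when asked for all
`k`) is to put the single NP-complete language `SAT` — or any ONE `PH`-presentable sparse language —
above a level. References: D. M. McKay, C. D. Murray, R. R. Williams, STOC 2019, §2 and §6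
("Sparse Problems?") [bib: McKayMurrayWilliams2019]; J. Hartmanis, R. E. Stearns, Trans. AMS 117
(1965), Thm. 9 [bib: HartmanisStearns1965]; L. Chen, C. Jin, R. R. Williams, *Hardness magnification
for all sparse NP languages*, FOCS 2019, Thm. 1.1–1.4.
-/

namespace Summit.PneNP.PneNP.Theorems.SoloBlind

open Literature.Computability.Complexity
open Literature.Computability.MetaComplexity
open Literature.Computability.MetaComplexity.McKayMurrayWilliams2019
open Literature.Barriers.PneNP (IsSparseLanguage)

/-! ### Sparse `P`-languages above every level, and PROPOSITION G′ in one-pass form -/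

/-- **For every `k` there is a SPARSE `L ∈ P` with `L ∉ USTREAM (Nᵏ+k) (Nᵏ+k)`**: take the sparse
`P`-language outside `DTIME(nᵈ)` of the sparse time hierarchy (`exists_sparse_mem_P_not_mem_DTIME_pow`)
for the exponent `d = d(k)` of THEOREM D♯. So every level of the family whose `SAT`-instance
calibrates the summit (THEOREM E: `PneNP ↔ ∀ k, SAT ∉ USTREAM (Nᵏ+k) (Nᵏ+k)`) is separated from
`P` unconditionally — by a sparse language. [cite: HartmanisStearns1965, Thm. 9 / Cor. 9.1] [cite: McKayMurrayWilliams2019, §2 and §6] -/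
theorem exists_sparse_mem_P_not_mem_USTREAM_pow (k : ℕ) :
    ∃ L : Language Bool, IsSparseLanguage L ∧ L ∈ Classes.P ∧
      L ∉ USTREAM (fun N => N ^ k + k) (fun N => N ^ k + k) := by
  obtain ⟨d, hd⟩ := exists_USTREAM_subset_DTIME_pow k
  obtain ⟨L, hs, hP, hD⟩ := exists_sparse_mem_P_not_mem_DTIME_pow d
  exact ⟨L, hs, hP, fun hL => hD (hd _ _ (fun _ => le_rfl) (fun _ => le_rfl) hL)⟩

/-- **PROPOSITION G′, ONE-PASS FORM (uniform streaming magnification for ALL sparse languages IS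
`P ≠ NP`).** For every `k`: "for every sparse `L ∈ P`, `NP ⊆ P` implies that `L` has a uniform
one-pass algorithm with `Nᵏ + k` space and update time" is equivalent to `PneNP` ((⇒) by
`exists_sparse_mem_P_not_mem_USTREAM_pow`, (⇐) vacuous). Compare THEOREM E: for the ONE language
`SAT` the same lower bound, asked at every level `k`, is the summit.
[cite: McKayMurrayWilliams2019, §6 ("Sparse Problems?")] [cite: HartmanisStearns1965, Thm. 9 / Cor. 9.1] -/
theorem sparseStreamingMagnification_iff_pneNP (k : ℕ) :
    (∀ L : Language Bool, IsSparseLanguage L → L ∈ Classes.P →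
        (Nondeterministic.NP ⊆ Classes.P →
          L ∈ USTREAM (fun N => N ^ k + k) (fun N => N ^ k + k))) ↔ PneNP := by
  rw [pneNP_iff_not_NP_subset_P]
  constructor
  · intro h hNP
    obtain ⟨L, hs, hP, hU⟩ := exists_sparse_mem_P_not_mem_USTREAM_pow k
    exact hU (h L hs hP hNP)
  · intro h L _ _ hNP
    exact absurd hNP h

/-- **One explicit sparse language whose one-pass magnification statement is the summit.**
[cite: McKayMurrayWilliams2019, §6 ("Sparse Problems?")] [cite: HartmanisStearns1965, Thm. 9 / Cor. 9.1] -/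
theorem exists_sparse_streamingMagnification_iff_pneNP (k : ℕ) :
    ∃ L : Language Bool, IsSparseLanguage L ∧ L ∈ Classes.P ∧
      ((Nondeterministic.NP ⊆ Classes.P →
          L ∈ USTREAM (fun N => N ^ k + k) (fun N => N ^ k + k)) ↔ PneNP) := by
  obtain ⟨L, hs, hP, hU⟩ := exists_sparse_mem_P_not_mem_USTREAM_pow k
  refine ⟨L, hs, hP, ?_⟩
  rw [pneNP_iff_not_NP_subset_P]
  exact ⟨fun h hNP => hU (h hNP), fun h hNP => absurd hNP h⟩

end Summit.PneNP.PneNP.Theorems.SoloBlind
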